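import Summits.QuantumFields.YangMills.Theorems.SwapVirialDeficitSectorLaplaceBulkIntegrated
import Summits.QuantumFields.YangMills.Theorems.SwapVirialDeficitSectorLaplaceWindow
import Summits.QuantumFields.YangMills.Theorems.SwapVirialDeficitSectorLaplaceMainConstFloor
import Summits.QuantumFields.YangMills.Theorems.SwapVirialDeficitBlowUpGnomonicZSignLargeField
import HarnessLib

/-!
# (S)-road under E1 (no gnomonic cut): THE HUB PARTITION `ℍ = Tip ⊔ End ⊔ Bulk`, the split S6a′ (unconditional) and the share-of-parts S5′
# in the letters of ✓`SectorLaplaceDefs` §4 (`hubIntegral`, `TipHub`, `EndHub`, `bulkHubIntegral`)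
# (free-hands support of ⟨stmt-QuantumFields-24197⟩ `SwapVirialDeficit.SwapGluedStiffness` ∕ ⟨24194⟩ `SwapMeanActionGap`; cell ym-idea-1, assembler fcl-p3 g47)

With w2 g59's rescaled fibre (E1, 2026-08-31 18:24Z∕18:35Z: ✓`rescaled_cubic_flat`, `bulk_fibred_plane`) the bulk fibred law holds on the WHOLE base `ℝ²`, so the
sector-000 assembly has a single cut, in the hub: `ℍ = TipHub ψ₀ ⊔ EndHub ψ₀ ⊔ HubBulk ψ₀`.  This file supplies, in the tree's letters:

* §1 the hub integral `I(a,ε;b) = hubIntegral a ε b`: `0 ≤ boxIntegral ≤ hubIntegral ≤ ∫ρ`, ★ `stronglyMeasurable_hubIntegral`, `integrable_hubIntegral` (`b ≥ 0`);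
* §2 the partition: measurability of `TipHub`∕`EndHub`, pairwise disjointness, `Tip ∪ (End ∪ Bulk) = univ` (`ψ₀ > 0`; `a = 0` is a tip hub), ★ `integral_eq_parts`;
* §3 ★ `goodIntegral_sub_bulkHubIntegral` — `good − bulkHub = K_L·Σ_{good ε}(∫_{Tip} I + ∫_{End} I)` EXACTLY; `mbConst_nonneg`;
* §4 ★★ `split_plane` — S6a′ UNCONDITIONALLY: `bulkHubIntegral ≤ goodIntegral ≤ chartIntegral`, `chart − good ≤ e^{−bc∕L⁶}` (w3 g66 ✓`badSign_floor`, `c = 1∕900`,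
  cone-a.e. hub via LEAD ✓`ae_re_ne_zero_im_ne_zero_coneMeasure`, total mass ✓`gnomonic_total_mass_real`);
* §5 ★★ `share_of_parts` — S5′ from the tip share S5a and the end share S5b (hypotheses): `good − bulkHub ≤ K L^k(ψ₀^κ + b^{−κ′})·(2π∕b)^α𝔐₀`
  (common exponents `κ = min`, `κ′ = min`, threshold `K = K_a + K_b + 1`, `k = max`; ✓`monomial_dom`).

HONEST LABEL: measure-theoretic glue; S5a∕S5b (the tip∕end shares — w3 g66 + w2 g59, conditional on one-loop determinant uniformity per LEAD 18:02Z) are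
HYPOTHESES of §5, NOT proved here; ⟨24197⟩ ∕ ⟨24194⟩ OPEN; ⟨24196⟩ proved elsewhere; item of record ⟨24085⟩ SubOctaveBounded aside ∕ untouched; the Yang–Mills
mass gap is NOT proved; no summit is proved by a line.  THEOREMS ONLY (0 `def`, 0 `sorry`), standard axioms; the `attribute [local instance]` block is the
chart's measurable structure on `ℍ` (as in ✓`SectorLaplaceDefs`; nothing overridden).  Seat ym-line-fcl-p3 g47 (cell ym-idea-1, free hands),
`--supports stmt-QuantumFields-24197`.  References: [cite: Luscher1983, §2]; [folklore].
-/

set_option autoImplicit false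
set_option synthInstance.maxSize 1024

noncomputable section

open MeasureTheory Quaternion Set
open scoped Quaternion BigOperators ENNReal
open Literature.MathematicalPhysics.QuantumLattice
open Literature.MathematicalPhysics.QuantumFieldTheory hiding SU2
open Summit.QuantumFields.YangMills.Theorems.SwapTwistDeficit.ToronLog

attribute [local instance] Literature.Analysis.FluidPDE.Tao2016.quatMeasurableSpace
  Literature.Analysis.FluidPDE.Tao2016.quatBorelSpace
  Literature.MathematicalPhysics.QuantumLattice.secondCountableTopology_su2

namespace Summit.QuantumFields.YangMills.Theorems.SwapVirialDeficit.SectorLaplace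

open Summit.QuantumFields.YangMills.Theorems.FemtoTransferGap
open Summit.QuantumFields.YangMills.Theorems.FemtoTransferGap.TT
open Summit.QuantumFields.YangMills.Theorems.VirialFluxGap.RingDeficit
open Summit.QuantumFields.YangMills.Theorems.SwapVirialDeficit.SwapRing
open Summit.QuantumFields.YangMills.Theorems.SwapVirialDeficit.BlowUpRing

variable {L : ℕ} [NeZero L]

/-! ## §1 The hub integral -/

/-- `0 ≤ hubIntegral`. [folklore] -/
theorem hubIntegral_nonneg (a : ℍ) (ε : GnoSign L) (b : ℝ) : 0 ≤ hubIntegral a ε b := by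
  unfold hubIntegral
  exact integral_nonneg fun η => fibreIntegrand_nonneg b a ε η

/-- `hubIntegral ≤ ∫ρ` (`b ≥ 0`). [folklore] -/
theorem hubIntegral_le_mass {b : ℝ} (hb : 0 ≤ b) (a : ℍ) (ε : GnoSign L) : hubIntegral a ε b ≤ ∫ η : GnoCoord L, gnoDensity η := by
  unfold hubIntegral
  refine integral_mono (integrable_fibreIntegrand hb a ε) integrable_gnoDensity fun η => ?_
  refine mul_le_of_le_one_left (gnoDensity_pos η).le (Real.exp_le_one_iff.2 ?_)
  have := gnoDeficit_nonneg z₀ (fun _ => (1 : SU2)) a ε η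
  nlinarith

/-- `boxIntegral ≤ hubIntegral` (`b ≥ 0`: the box integrand is the restriction of a non-negative one). [folklore] -/
theorem boxIntegral_le_hubIntegral {b : ℝ} (hb : 0 ≤ b) (a : ℍ) (ε : GnoSign L) (V₀ : ℝ) : boxIntegral a ε b V₀ ≤ hubIntegral a ε b := by
  unfold boxIntegral hubIntegral
  exact integral_mono ((integrable_fibreIntegrand hb a ε).indicator (measurableSet_gnoBox V₀)) (integrable_fibreIntegrand hb a ε)
    (fun η => Set.indicator_le_self' (fun x _ => fibreIntegrand_nonneg b a ε x) η)

/-- ★ `a ↦ hubIntegral a ε b` is strongly measurable in the hub (✓`measurable_gnoDeficit_uncurry` + `StronglyMeasurable.integral_prod_right'`). [folklore] -/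
theorem stronglyMeasurable_hubIntegral (ε : GnoSign L) (b : ℝ) : StronglyMeasurable fun a : ℍ => hubIntegral a ε b := by
  have hF : Measurable fun p : ℍ × GnoCoord L => Real.exp (-(b * gnoDeficit z₀ (fun _ => 1) p.1 ε p.2)) * gnoDensity p.2 :=
    (((measurable_gnoDeficit_uncurry z₀ (fun _ => 1) ε).const_mul b).neg.exp.mul (measurable_gnoDensity.comp measurable_snd))
  have h := hF.stronglyMeasurable.integral_prod_right' (ν := (volume : Measure (GnoCoord L)))
  exact h

/-- `a ↦ hubIntegral a ε b` is integrable for the (probability) cone law (`b ≥ 0`). [folklore] -/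
theorem integrable_hubIntegral {b : ℝ} (hb : 0 ≤ b) (ε : GnoSign L) : Integrable (fun a : ℍ => hubIntegral a ε b) coneMeasure := by
  haveI := isProbabilityMeasure_coneMeasure
  refine (integrable_const (∫ η : GnoCoord L, gnoDensity η)).mono' (stronglyMeasurable_hubIntegral ε b).aestronglyMeasurable
    (Filter.Eventually.of_forall fun a => ?_)
  rw [Real.norm_eq_abs, abs_of_nonneg (hubIntegral_nonneg a ε b)]
  exact hubIntegral_le_mass hb a ε

/-! ## §2 The partition of the hubs -/

/-- `TipHub ψ₀` is measurable. [folklore] -/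
theorem measurableSet_tipHub (ψ₀ : ℝ) : MeasurableSet (TipHub ψ₀) :=
  measurableSet_lt measurable_hubS2 measurable_const

/-- `EndHub ψ₀` is measurable. [folklore] -/
theorem measurableSet_endHub (ψ₀ : ℝ) : MeasurableSet (EndHub ψ₀) := by
  have e : EndHub ψ₀ = {a : ℍ | hubS1 a < ψ₀} ∩ {a : ℍ | ψ₀ ≤ hubS2 a} := by
    ext a; simp only [EndHub, Set.mem_setOf_eq, Set.mem_inter_iff]
  rw [e]
  exact (measurableSet_lt measurable_hubS1 measurable_const).inter (measurableSet_le measurable_const measurable_hubS2)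

/-- The zero hub has `sin²ψ = 0`: it is a tip hub for every `ψ₀ > 0`. [folklore] -/
theorem hubS2_zero : hubS2 0 = 0 := by
  simp [hubS2]

/-- Tip and end hubs are disjoint. [folklore] -/
theorem disjoint_tipHub_endHub (ψ₀ : ℝ) : Disjoint (TipHub ψ₀) (EndHub ψ₀) :=
  Set.disjoint_left.2 fun _ ha hb => absurd ha.out (not_lt.2 hb.2)

/-- Tip and bulk hubs are disjoint. [folklore] -/
theorem disjoint_tipHub_hubBulk (ψ₀ : ℝ) : Disjoint (TipHub ψ₀) (HubBulk ψ₀) :=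
  Set.disjoint_left.2 fun _ ha hb => absurd ha.out (not_lt.2 hb.2.2)

/-- End and bulk hubs are disjoint. [folklore] -/
theorem disjoint_endHub_hubBulk (ψ₀ : ℝ) : Disjoint (EndHub ψ₀) (HubBulk ψ₀) :=
  Set.disjoint_left.2 fun _ ha hb => absurd ha.1 (not_lt.2 hb.2.1)

/-- ★ THE PARTITION: `TipHub ψ₀ ∪ (EndHub ψ₀ ∪ HubBulk ψ₀) = ℍ` for `ψ₀ > 0`. [folklore] -/
theorem tipHub_union (ψ₀ : ℝ) (hψ₀ : 0 < ψ₀) : TipHub ψ₀ ∪ (EndHub ψ₀ ∪ HubBulk ψ₀) = Set.univ := by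
  refine Set.eq_univ_of_forall fun a => ?_
  by_cases h2 : hubS2 a < ψ₀
  · exact Or.inl h2
  · have h2' : ψ₀ ≤ hubS2 a := not_lt.1 h2
    by_cases h1 : hubS1 a < ψ₀
    · exact Or.inr (Or.inl ⟨h1, h2'⟩)
    · have ha : a ≠ 0 := by
        rintro rfl
        rw [hubS2_zero] at h2'
        exact absurd h2' (not_le.2 hψ₀)
      exact Or.inr (Or.inr ⟨ha, not_lt.1 h1, h2'⟩)

/-- ★ Every cone-integrable `f` splits over the partition. [folklore] -/
theorem integral_eq_parts {f : ℍ → ℝ} (hf : Integrable f coneMeasure) {ψ₀ : ℝ} (hψ₀ : 0 < ψ₀) :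
    ∫ a, f a ∂coneMeasure =
      ∫ a in TipHub ψ₀, f a ∂coneMeasure + ∫ a in EndHub ψ₀, f a ∂coneMeasure + ∫ a in HubBulk ψ₀, f a ∂coneMeasure := by
  rw [← setIntegral_univ (μ := coneMeasure) (f := f), ← tipHub_union ψ₀ hψ₀,
    setIntegral_union ((disjoint_tipHub_endHub ψ₀).union_right (disjoint_tipHub_hubBulk ψ₀))
      ((measurableSet_endHub ψ₀).union (measurableSet_hubBulk ψ₀)) hf.integrableOn hf.integrableOn,
    setIntegral_union (disjoint_endHub_hubBulk ψ₀) (measurableSet_hubBulk ψ₀) hf.integrableOn hf.integrableOn, add_assoc]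

/-! ## §3 The good-sign integral minus its bulk-hub part -/

/-- The chart constant is non-negative. [folklore] -/
theorem KL_nonneg : 0 ≤ KL L := by
  have := coneConst_pos; unfold KL; positivity

/-- ★ `goodIntegral − bulkHubIntegral = K_L·Σ_{good ε}(∫_{TipHub} I + ∫_{EndHub} I)` EXACTLY (`ψ₀ > 0`, `b ≥ 0`). [folklore] -/
theorem goodIntegral_sub_bulkHubIntegral {ψ₀ b : ℝ} (hψ₀ : 0 < ψ₀) (hb : 0 ≤ b) :
    goodIntegral L b - bulkHubIntegral L b ψ₀ =
      KL L * ∑ ε ∈ (Finset.univ.filter fun ε : GnoSign L => GoodSign ε),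
        (∫ a in TipHub ψ₀, hubIntegral a ε b ∂coneMeasure + ∫ a in EndHub ψ₀, hubIntegral a ε b ∂coneMeasure) := by
  have e2 : ∀ ε : GnoSign L, ∫ a, hubIntegral a ε b ∂coneMeasure = ∫ a in TipHub ψ₀, hubIntegral a ε b ∂coneMeasure +
      ∫ a in EndHub ψ₀, hubIntegral a ε b ∂coneMeasure + ∫ a in HubBulk ψ₀, hubIntegral a ε b ∂coneMeasure :=
    fun ε => integral_eq_parts (integrable_hubIntegral hb ε) hψ₀
  have e1 : goodIntegral L b = KL L * ∑ ε ∈ (Finset.univ.filter fun ε : GnoSign L => GoodSign ε), ∫ a, hubIntegral a ε b ∂coneMeasure := by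
    unfold goodIntegral hubIntegral
    rfl
  have e3 : bulkHubIntegral L b ψ₀ =
      KL L * ∑ ε ∈ (Finset.univ.filter fun ε : GnoSign L => GoodSign ε), ∫ a in HubBulk ψ₀, hubIntegral a ε b ∂coneMeasure := rfl
  rw [e1, e3, ← mul_sub, ← Finset.sum_sub_distrib]
  refine congrArg (fun t => KL L * t) (Finset.sum_congr rfl fun ε _ => ?_)
  rw [e2 ε, add_sub_cancel_right]

/-- `0 ≤ mbConst` (Bochner integrals of a non-negative integrand; no integrability needed). [folklore] -/
theorem mbConst_nonneg : 0 ≤ mbConst L := by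
  unfold mbConst
  exact mul_nonneg KL_nonneg (Finset.sum_nonneg fun ε _ => integral_nonneg fun a => integral_nonneg fun p => mbDensity_nonneg a ε p)

/-! ## §4 S6a′ — the split, unconditionally -/

set_option maxHeartbeats 400000 in
/-- ★★ **S6a′ — THE SPLIT (no gnomonic cut)**: `bulkHubIntegral ≤ goodIntegral ≤ chartIntegral` and `chartIntegral − goodIntegral ≤ e^{−b·c∕L⁶}` with w3 g66's
bad-sign floor `c = 1∕900` (✓`badSign_floor`, every hub `a ≠ 0` — cone-a.e. by ✓`ae_re_ne_zero_im_ne_zero_coneMeasure`) and the total mass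
`K_L·Σ_ε∫ρ = 1` (✓`gnomonic_total_mass_real`). [cite: Luscher1983, §2] -/
theorem split_plane : ∃ c : ℝ, 0 < c ∧ ∀ (L : ℕ) [NeZero L] (ψ₀ b : ℝ), 0 ≤ b →
    bulkHubIntegral L b ψ₀ ≤ goodIntegral L b ∧ goodIntegral L b ≤ chartIntegral L b ∧
      chartIntegral L b - goodIntegral L b ≤ Real.exp (-(b * (c / (L : ℝ) ^ 6))) := by
  obtain ⟨c, hc, hfloor⟩ := badSign_floor
  refine ⟨c, hc, fun L _ ψ₀ b hb => ?_⟩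
  haveI := isProbabilityMeasure_coneMeasure
  have hIint : ∀ ε : GnoSign L, Integrable (fun a : ℍ => hubIntegral a ε b) coneMeasure := fun ε => integrable_hubIntegral hb ε
  have hInn : ∀ (a : ℍ) (ε : GnoSign L), 0 ≤ hubIntegral a ε b := fun a ε => hubIntegral_nonneg a ε b
  have hKL : 0 ≤ KL L := KL_nonneg
  have hρ : 0 ≤ ∫ η : GnoCoord L, gnoDensity η := integral_nonneg fun η => (gnoDensity_pos η).le
  have eg : goodIntegral L b = KL L * ∑ ε ∈ (Finset.univ.filter fun ε : GnoSign L => GoodSign ε), ∫ a, hubIntegral a ε b ∂coneMeasure := by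
    unfold goodIntegral hubIntegral
    rfl
  have ec : chartIntegral L b = KL L * ∫ a, (∑ ε : GnoSign L, hubIntegral a ε b) ∂coneMeasure := by
    unfold chartIntegral hubIntegral
    rfl
  refine ⟨?_, ?_, ?_⟩
  · -- (i) `bulkHub ≤ good`: bulk hubs ⊆ all hubs, integrand ≥ 0
    rw [eg]; unfold bulkHubIntegral
    refine mul_le_mul_of_nonneg_left (Finset.sum_le_sum fun ε _ => ?_) hKL
    exact setIntegral_le_integral (hIint ε) (Filter.Eventually.of_forall fun a => hInn a ε)
  · -- (ii) `good ≤ chart`: drop the bad signs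
    rw [eg, ec, integral_finsetSum _ fun ε _ => hIint ε]
    refine mul_le_mul_of_nonneg_left ?_ hKL
    exact Finset.sum_le_sum_of_subset_of_nonneg (Finset.filter_subset _ _) fun ε _ _ => integral_nonneg fun a => hInn a ε
  · -- (iii) the bad signs: `F̂ ≥ c∕L⁶` at every hub `a ≠ 0` (cone-a.e.), total mass `1`
    rw [eg, ec, integral_finsetSum _ fun ε _ => hIint ε, ← mul_sub,
      ← Finset.sum_filter_add_sum_filter_not Finset.univ (fun ε : GnoSign L => GoodSign ε), add_sub_cancel_left]
    have hbad : ∀ ε ∈ Finset.univ.filter (fun ε : GnoSign L => ¬ GoodSign ε),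
        ∫ a, hubIntegral a ε b ∂coneMeasure ≤ Real.exp (-(b * (c / (L : ℝ) ^ 6))) * ∫ η : GnoCoord L, gnoDensity η := by
      intro ε hε
      rw [Finset.mem_filter] at hε
      have hpt : ∀ a : ℍ, a ≠ 0 → hubIntegral a ε b ≤ Real.exp (-(b * (c / (L : ℝ) ^ 6))) * ∫ η : GnoCoord L, gnoDensity η := by
        intro a ha
        unfold hubIntegral
        rw [← integral_const_mul]
        refine integral_mono (integrable_fibreIntegrand hb a ε) (integrable_gnoDensity.const_mul _) fun η => ?_
        refine mul_le_mul_of_nonneg_right (Real.exp_le_exp.2 ?_) (gnoDensity_pos η).le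
        have h1 := hfloor L a ha ε hε.2 η
        nlinarith
      calc ∫ a, hubIntegral a ε b ∂coneMeasure
          ≤ ∫ _a : ℍ, (Real.exp (-(b * (c / (L : ℝ) ^ 6))) * ∫ η : GnoCoord L, gnoDensity η) ∂coneMeasure :=
            integral_mono_ae (hIint ε) (integrable_const _)
              (ae_re_ne_zero_im_ne_zero_coneMeasure.mono fun a ha => hpt a fun h0 => ha.1 (by rw [h0]; rfl))
        _ = Real.exp (-(b * (c / (L : ℝ) ^ 6))) * ∫ η : GnoCoord L, gnoDensity η := by
            rw [integral_const, probReal_univ, one_smul]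
    have htot := gnomonic_total_mass_real (L := L) (χ := fun _ => (1 : SU2)) one_central
    calc KL L * ∑ ε ∈ Finset.univ.filter (fun ε : GnoSign L => ¬ GoodSign ε), ∫ a, hubIntegral a ε b ∂coneMeasure
        ≤ KL L * ∑ ε ∈ Finset.univ.filter (fun ε : GnoSign L => ¬ GoodSign ε), Real.exp (-(b * (c / (L : ℝ) ^ 6))) * ∫ η : GnoCoord L, gnoDensity η :=
          mul_le_mul_of_nonneg_left (Finset.sum_le_sum hbad) hKL
      _ ≤ KL L * ∑ _ε : GnoSign L, Real.exp (-(b * (c / (L : ℝ) ^ 6))) * ∫ η : GnoCoord L, gnoDensity η :=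
          mul_le_mul_of_nonneg_left (Finset.sum_le_sum_of_subset_of_nonneg (Finset.filter_subset _ _) fun ε _ _ => by positivity) hKL
      _ = Real.exp (-(b * (c / (L : ℝ) ^ 6))) * (KL L * ∑ _ε : GnoSign L, ∫ η : GnoCoord L, gnoDensity η) := by
          rw [Finset.mul_sum, Finset.mul_sum, Finset.mul_sum]
          exact Finset.sum_congr rfl fun ε _ => by ring
      _ = Real.exp (-(b * (c / (L : ℝ) ^ 6))) := by unfold KL; rw [htot, mul_one]

/-! ## §5 S5′ — the share outside the bulk hubs, from the tip share and the end share -/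

set_option maxHeartbeats 400000 in
/-- ★★ **S5′ — THE SHARE OF PARTS**: if the tip hubs carry `≤ K_a L^{k_a}(ψ₀^{κ_a} + b^{−κ′_a})` of the full main term (stub S5a) and the end hubs
`≤ K_b L^{k_b}(ψ₀^{κ_b} + b^{−κ′_b})` (stub S5b), then `goodIntegral − bulkHubIntegral ≤ K L^k(ψ₀^κ + b^{−κ′})·(2π∕b)^α𝔐₀` with `K = K_a + K_b + 1`,
`k = max`, `κ = min`, `κ′ = min` (§3: the difference IS the sum of the two parts). [cite: Luscher1983, §2] -/
theorem share_of_parts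
    (h5a : ∃ K : ℝ, 0 < K ∧ ∃ κ : ℝ, 0 < κ ∧ ∃ κ' : ℝ, 0 < κ' ∧ ∃ k : ℕ, ∀ (L : ℕ) [NeZero L] (ψ₀ b : ℝ),
      0 < ψ₀ → ψ₀ ≤ 1 → K * (L : ℝ) ^ k ≤ b →
        KL L * ∑ ε ∈ (Finset.univ.filter fun ε : GnoSign L => GoodSign ε), ∫ a in TipHub ψ₀, hubIntegral a ε b ∂coneMeasure ≤
          K * (L : ℝ) ^ k * (ψ₀ ^ κ + b ^ (-κ')) * ((2 * Real.pi / b) ^ alpha L * mbConst L))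
    (h5b : ∃ K : ℝ, 0 < K ∧ ∃ κ : ℝ, 0 < κ ∧ ∃ κ' : ℝ, 0 < κ' ∧ ∃ k : ℕ, ∀ (L : ℕ) [NeZero L] (ψ₀ b : ℝ),
      0 < ψ₀ → ψ₀ ≤ 1 → K * (L : ℝ) ^ k ≤ b →
        KL L * ∑ ε ∈ (Finset.univ.filter fun ε : GnoSign L => GoodSign ε), ∫ a in EndHub ψ₀, hubIntegral a ε b ∂coneMeasure ≤
          K * (L : ℝ) ^ k * (ψ₀ ^ κ + b ^ (-κ')) * ((2 * Real.pi / b) ^ alpha L * mbConst L)) :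
    ∃ K : ℝ, 0 < K ∧ ∃ κ : ℝ, 0 < κ ∧ ∃ κ' : ℝ, 0 < κ' ∧ ∃ k : ℕ, ∀ (L : ℕ) [NeZero L] (ψ₀ b : ℝ),
      0 < ψ₀ → ψ₀ ≤ 1 → K * (L : ℝ) ^ k ≤ b →
        goodIntegral L b - bulkHubIntegral L b ψ₀ ≤ K * (L : ℝ) ^ k * (ψ₀ ^ κ + b ^ (-κ')) * ((2 * Real.pi / b) ^ alpha L * mbConst L) := by
  obtain ⟨Ka, hKa, κa, hκa, κa', hκa', ka, ha⟩ := h5a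
  obtain ⟨Kb, hKb, κb, hκb, κb', hκb', kb, hb5⟩ := h5b
  refine ⟨Ka + Kb + 1, by positivity, min κa κb, lt_min hκa hκb, min κa' κb', lt_min hκa' hκb', max ka kb,
    fun L _ ψ₀ b hψ0 hψ1 hb => ?_⟩
  have hL1 : (1 : ℝ) ≤ L := by exact_mod_cast NeZero.one_le
  have hLk : (1 : ℝ) ≤ (L : ℝ) ^ max ka kb := one_le_pow₀ hL1
  have hb1 : 1 ≤ b := le_trans (le_trans (by linarith) (le_mul_of_one_le_right (by positivity) hLk)) hb
  have hb0 : 0 < b := by linarith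
  -- the two thresholds
  have hta : Ka * (L : ℝ) ^ ka ≤ b := (monomial_dom hL1 hKa.le (by linarith) (le_max_left ka kb)).trans hb
  have htb : Kb * (L : ℝ) ^ kb ≤ b := (monomial_dom hL1 hKb.le (by linarith) (le_max_right ka kb)).trans hb
  have hA := ha L ψ₀ b hψ0 hψ1 hta
  have hB := hb5 L ψ₀ b hψ0 hψ1 htb
  -- the main term is non-negative
  have hM0 : 0 ≤ (2 * Real.pi / b) ^ alpha L * mbConst L := mul_nonneg (Real.rpow_nonneg (div_pos Real.two_pi_pos hb0).le _) mbConst_nonneg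
  -- monotonicity of the rates
  have hψa : ψ₀ ^ κa ≤ ψ₀ ^ min κa κb := Real.rpow_le_rpow_of_exponent_ge hψ0 hψ1 (min_le_left _ _)
  have hψb : ψ₀ ^ κb ≤ ψ₀ ^ min κa κb := Real.rpow_le_rpow_of_exponent_ge hψ0 hψ1 (min_le_right _ _)
  have hba : b ^ (-κa') ≤ b ^ (-min κa' κb') := Real.rpow_le_rpow_of_exponent_le hb1 (neg_le_neg (min_le_left _ _))
  have hbb : b ^ (-κb') ≤ b ^ (-min κa' κb') := Real.rpow_le_rpow_of_exponent_le hb1 (neg_le_neg (min_le_right _ _))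
  have hLa : (L : ℝ) ^ ka ≤ (L : ℝ) ^ max ka kb := pow_le_pow_right₀ hL1 (le_max_left _ _)
  have hLb : (L : ℝ) ^ kb ≤ (L : ℝ) ^ max ka kb := pow_le_pow_right₀ hL1 (le_max_right _ _)
  have hR0 : 0 ≤ ψ₀ ^ min κa κb + b ^ (-min κa' κb') := add_nonneg (Real.rpow_nonneg hψ0.le _) (Real.rpow_nonneg hb0.le _)
  have iA : Ka * (L : ℝ) ^ ka * (ψ₀ ^ κa + b ^ (-κa')) ≤ Ka * (L : ℝ) ^ max ka kb * (ψ₀ ^ min κa κb + b ^ (-min κa' κb')) :=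
    mul_le_mul (mul_le_mul_of_nonneg_left hLa hKa.le) (add_le_add hψa hba) (add_nonneg (Real.rpow_nonneg hψ0.le _) (Real.rpow_nonneg hb0.le _))
      (by positivity)
  have iB : Kb * (L : ℝ) ^ kb * (ψ₀ ^ κb + b ^ (-κb')) ≤ Kb * (L : ℝ) ^ max ka kb * (ψ₀ ^ min κa κb + b ^ (-min κa' κb')) :=
    mul_le_mul (mul_le_mul_of_nonneg_left hLb hKb.le) (add_le_add hψb hbb) (add_nonneg (Real.rpow_nonneg hψ0.le _) (Real.rpow_nonneg hb0.le _))
      (by positivity)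
  -- the identity of §3 and the sum of the two shares
  rw [goodIntegral_sub_bulkHubIntegral hψ0 hb0.le, Finset.sum_add_distrib, mul_add]
  have h1 : (1 : ℝ) * (L : ℝ) ^ max ka kb * (ψ₀ ^ min κa κb + b ^ (-min κa' κb')) * ((2 * Real.pi / b) ^ alpha L * mbConst L) ≥ 0 := by positivity
  calc KL L * ∑ ε ∈ (Finset.univ.filter fun ε : GnoSign L => GoodSign ε), ∫ a in TipHub ψ₀, hubIntegral a ε b ∂coneMeasure +
        KL L * ∑ ε ∈ (Finset.univ.filter fun ε : GnoSign L => GoodSign ε), ∫ a in EndHub ψ₀, hubIntegral a ε b ∂coneMeasure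
      ≤ Ka * (L : ℝ) ^ ka * (ψ₀ ^ κa + b ^ (-κa')) * ((2 * Real.pi / b) ^ alpha L * mbConst L) +
          Kb * (L : ℝ) ^ kb * (ψ₀ ^ κb + b ^ (-κb')) * ((2 * Real.pi / b) ^ alpha L * mbConst L) := add_le_add hA hB
    _ ≤ Ka * (L : ℝ) ^ max ka kb * (ψ₀ ^ min κa κb + b ^ (-min κa' κb')) * ((2 * Real.pi / b) ^ alpha L * mbConst L) +
          Kb * (L : ℝ) ^ max ka kb * (ψ₀ ^ min κa κb + b ^ (-min κa' κb')) * ((2 * Real.pi / b) ^ alpha L * mbConst L) :=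
        add_le_add (mul_le_mul_of_nonneg_right iA hM0) (mul_le_mul_of_nonneg_right iB hM0)
    _ ≤ (Ka + Kb + 1) * (L : ℝ) ^ max ka kb * (ψ₀ ^ min κa κb + b ^ (-min κa' κb')) * ((2 * Real.pi / b) ^ alpha L * mbConst L) := by
        nlinarith [h1]

end Summit.QuantumFields.YangMills.Theorems.SwapVirialDeficit.SectorLaplace

end
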